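import Mathlib
import Literature.Probability.RandomPlanarGeometry.ChordalCurveFamily
import Literature.Probability.RandomPlanarGeometry.CurveClassStopAtMeasurable
import HarnessLib

/-!
# The `markov` clause of a domain-Markov extension, functional form

Crux `AxiomsOfLimit` (stmt-CriticalPhenomena-1370), line `registered`, stub `stub_markov_lintegral`
(lead c5). Theorems only.

The `markov` clause of `ChordalFamily.IsMarkovExtension P Q` says that for every Dobrushin domain
`D` and every closed `F ⊆ ℂ` the law `P D` disintegrates along `γ ↦ (γ.stopAt F, γ.startFrom F)`
through the kernel `Q D`:
`P D {stopAt F ∈ S, startFrom F ∈ T} = ∫⁻ γ in stopAt F ⁻¹' S, Q D (γ.stopAt F) T ∂(P D)`.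
This file proves the same identity with the indicator of `{stopAt F ∈ S}` replaced by an arbitrary
measurable `h (γ.stopAt F)`, `h : CurveClass ℂ → ℝ≥0∞`:
`∫⁻ γ in startFrom F ⁻¹' T, h (γ.stopAt F) ∂(P D) = ∫⁻ γ, h (γ.stopAt F) * Q D (γ.stopAt F) T ∂(P D)`.

Proof: the two measures `(P D)|{startFrom F ∈ T}` and `(P D).withDensity (Q D (stopAt F ·) T)`
have the same push-forward under `stopAt F` (this IS the `markov` clause, set by set), and both
sides of the goal are the integral of `h` against that push-forward.

References: W. Werner, *Lectures on two-dimensional critical percolation* (2007) §3.2 (2);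
O. Schramm, Israel J. Math. 118 (2000) §1. All [folklore].
-/

noncomputable section

open MeasureTheory Set
open scoped ENNReal

namespace Summit.CriticalPhenomena.SAWScalingLimit.Theorems.AxiomsOfLimitKernelClause

open Literature.Probability.RandomPlanarGeometry

/-- **The `markov` clause as an equality of push-forwards.** For a Markov extension `Q` of `P`,
a Dobrushin domain `D`, a closed `F` and a Borel `T` with `p ↦ Q D p T` measurable, the
push-forwards under `stopAt F` of `(P D)|{startFrom F ∈ T}` and of
`(P D).withDensity (γ ↦ Q D (γ.stopAt F) T)` coincide: evaluated on a Borel `S` this is literally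
the `markov` clause. [folklore] -/
theorem MarkovLintegral.map_restrict_eq_map_withDensity {P : ChordalFamily}
    {Q : DobrushinDomain → CurveClass ℂ → Measure (CurveClass ℂ)} (hPQ : P.IsMarkovExtension Q)
    (D : DobrushinDomain) {F : Set ℂ} (hF : IsClosed F) {T : Set (CurveClass ℂ)}
    (hT : MeasurableSet T) :
    ((P D).restrict (CurveClass.startFrom F ⁻¹' T)).map (CurveClass.stopAt F) =
      ((P D).withDensity fun γ => Q D (γ.stopAt F) T).map (CurveClass.stopAt F) := by
  have hg : Measurable (CurveClass.stopAt F : CurveClass ℂ → CurveClass ℂ) :=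
    CurveClass.measurable_stopAt hF
  refine Measure.ext fun S hS => ?_
  rw [Measure.map_apply hg hS, Measure.map_apply hg hS, Measure.restrict_apply (hS.preimage hg),
    withDensity_apply _ (hS.preimage hg)]
  exact hPQ.markov D F hF S T hS hT

/-- **The `markov` clause in functional form.** If `Q` is a domain-Markov extension of the chordal
family `P`, `D` is a Dobrushin domain, `F ⊆ ℂ` is closed, `T` is Borel with `p ↦ Q D p T`
measurable, and `h : CurveClass ℂ → ℝ≥0∞` is measurable, then
`∫⁻ γ in startFrom F ⁻¹' T, h (γ.stopAt F) ∂(P D) = ∫⁻ γ, h (γ.stopAt F) * Q D (γ.stopAt F) T ∂(P D)`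
(for `h` the indicator of `stopAt F ⁻¹' S` this is the `markov` clause itself). [folklore] -/
theorem stub_markov_lintegral : ∀ (P : Literature.Probability.RandomPlanarGeometry.ChordalFamily) (Q : Literature.Probability.RandomPlanarGeometry.DobrushinDomain → Literature.Probability.RandomPlanarGeometry.CurveClass ℂ → MeasureTheory.Measure (Literature.Probability.RandomPlanarGeometry.CurveClass ℂ)), P.IsMarkovExtension Q → ∀ (D : Literature.Probability.RandomPlanarGeometry.DobrushinDomain) (F : Set ℂ), IsClosed F → ∀ (T : Set (Literature.Probability.RandomPlanarGeometry.CurveClass ℂ)), MeasurableSet T → (Measurable fun p : Literature.Probability.RandomPlanarGeometry.CurveClass ℂ => Q D p T) → ∀ (h : Literature.Probability.RandomPlanarGeometry.CurveClass ℂ → ENNReal), Measurable h → MeasureTheory.lintegral ((P D).restrict (Literature.Probability.RandomPlanarGeometry.CurveClass.startFrom F ⁻¹' T)) (fun γ => h (γ.stopAt F)) = MeasureTheory.lintegral (P D) (fun γ => h (γ.stopAt F) * Q D (γ.stopAt F) T) := by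
  intro P Q hPQ D F hF T hT hQm h hh
  have hg : Measurable (CurveClass.stopAt F : CurveClass ℂ → CurveClass ℂ) :=
    CurveClass.measurable_stopAt hF
  have hd : Measurable fun γ : CurveClass ℂ => Q D (γ.stopAt F) T := hQm.comp hg
  have hhg : Measurable fun γ : CurveClass ℂ => h (γ.stopAt F) := hh.comp hg
  have key := congrArg (fun m : Measure (CurveClass ℂ) => ∫⁻ p, h p ∂m)
    (MarkovLintegral.map_restrict_eq_map_withDensity hPQ D hF hT)
  rw [lintegral_map hh hg, lintegral_map hh hg,
    lintegral_withDensity_eq_lintegral_mul _ hd hhg] at key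
  rw [key]
  refine lintegral_congr fun γ => ?_
  rw [Pi.mul_apply, mul_comm]

end Summit.CriticalPhenomena.SAWScalingLimit.Theorems.AxiomsOfLimitKernelClause

end
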